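import Summits.QuantumFields.QCD.Theorems.QuarksAsStableActionSmallHoppingDiamagnetismPaths
import Summits.QuantumFields.QCD.Theorems.QuarksAsStableActionSmallHoppingDiamagnetismSpectral
import Summits.QuantumFields.QCD.Theorems.QuarksAsStableActionSmallHoppingDiamagnetismLogDet
import Literature.MathematicalPhysics.QuantumLattice.OverlapLocality

/-!
# Small-hopping diamagnetism (stmt-QuantumFields-9738): the convergent `log det` expansion of `1 - κ H`

Helper file for the support item `SmallHoppingDiamagnetism` of route `QuarksAsStableAction`.
For a unitary matrix representation `ρ` and any gauge field `V` on the four-torus, the Wilson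
hopping matrix `H = hopMatrix ρ V` (`D_W = (m + 4)(1 - κ H)`, `κ = (2m + 8)⁻¹`) satisfies

* `hopMatrix_eq_two_smul_sum_wilsonHop` : `H = 2 Σ_μ W_μ` with the tree's isometric hopping matrices
  `W_μ` (`OverlapLocality.wilsonHop`), hence `l2_opNorm_hopMatrix_le` : `‖H‖ ≤ 8` and
  `norm_le_eight_of_mem_roots` : every characteristic root of `H` has modulus `≤ 8`;
* `logDet_hopMatrix` : for `0 ≤ κ`, `8κ < 1`: `det (1 - κ H) ≠ 0`, the series `Σ_k κᵏ tr(Hᵏ)/k`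
  converges and `log |det (1 - κ H)| = - Re Σ_k κᵏ tr(Hᵏ)/k` (the sibling `…LogDet` /
  `…Spectral` files instantiated);
* `norm_term_hopMatrix_le` : `‖κᵏ tr(Hᵏ)/k‖ ≤ dim · (8κ)ᵏ / k`, `dim = 4 N L⁴` (`card_index`);
* `log_norm_det_sub_eq` / `norm_tsum_tail_sub_le` : for two gauge fields the difference of the two
  `log |det|` splits into the first `K` terms plus a tail of size `≤ (2 dim / K) (8κ)^K / (1 - 8κ)`.

Mathlib + tree only; no statement of the route is restated.
-/

noncomputable section

namespace Summit.QuantumFields.QCD.Theorems.SmallHopping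

open Literature.Probability.LatticeModels Literature.MathematicalPhysics.QuantumLattice
  Literature.MathematicalPhysics.QuantumFieldTheory Matrix

variable {L N : ℕ} {G : Type*} [Group G] (ρ : G →* Matrix (Fin N) (Fin N) ℂ)
  (hρ : ∀ g, ρ g ∈ Matrix.unitaryGroup (Fin N) ℂ) [NeZero L]

/-! ## The hopping matrix and the isometric hopping matrices -/

section Norm

open scoped Matrix.Norms.L2Operator

omit [NeZero L] in
include hρ in
/-- `H = 2 Σ_μ W_μ`: the word-expansion hopping matrix is twice the sum of the tree's isometric
hopping matrices (compare `D_W = (m+4)(1 - κ H)` with `D_W = (m+4)·1 - Σ_μ W_μ` at `m = 0`). -/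
theorem hopMatrix_eq_two_smul_sum_wilsonHop (V : GaugeConfig 4 L G) :
    hopMatrix ρ V = (2 : ℂ) • ∑ μ, wilsonHop ρ V μ := by
  have h1 := wilsonDirac_eq_smul_one_sub ρ V 0 (by norm_num)
  have h2 := wilsonDirac_eq_sub_sum_wilsonHop ρ hρ V 0
  rw [h2, smul_sub, smul_smul] at h1
  have h3 := sub_right_inj.mp h1
  have h4 : ((0 + 4 : ℝ) : ℂ) * (((2 * 0 + 8)⁻¹ : ℝ) : ℂ) = (2 : ℂ)⁻¹ := by
    push_cast; norm_num
  rw [h4] at h3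
  rw [h3, smul_smul]
  norm_num

include hρ in
/-- **`‖H‖ ≤ 8`** in the `ℓ²` operator norm. -/
theorem l2_opNorm_hopMatrix_le (V : GaugeConfig 4 L G) : ‖hopMatrix ρ V‖ ≤ 8 := by
  rw [hopMatrix_eq_two_smul_sum_wilsonHop ρ hρ V]
  calc ‖(2 : ℂ) • ∑ μ, wilsonHop ρ V μ‖ ≤ ‖(2 : ℂ)‖ * ‖∑ μ, wilsonHop ρ V μ‖ := norm_smul_le _ _
    _ ≤ 2 * ∑ μ : Fin 4, ‖wilsonHop ρ V μ‖ := by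
        rw [Complex.norm_ofNat]
        exact mul_le_mul_of_nonneg_left (norm_sum_le _ _) (by norm_num)
    _ ≤ 2 * ∑ _μ : Fin 4, (1 : ℝ) := by
        apply mul_le_mul_of_nonneg_left _ (by norm_num)
        exact Finset.sum_le_sum fun μ _ => l2_opNorm_wilsonHop_le ρ hρ V μ
    _ = 8 := by norm_num

include hρ in
/-- **Every characteristic root of `H` has modulus `≤ 8`** (eigenvector relation plus `‖H‖ ≤ 8`). -/
theorem norm_le_eight_of_mem_roots (V : GaugeConfig 4 L G) {z : ℂ}
    (hz : z ∈ (hopMatrix ρ V).charpoly.roots) : ‖z‖ ≤ 8 := by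
  refine norm_le_of_mem_roots _ (fun z v hv hHv => ?_) hz
  have h1 := sum_norm_sq_mulVec_le (hopMatrix ρ V) v
  rw [hHv] at h1
  have h2 : ∑ i, ‖(z • v) i‖ ^ 2 = ‖z‖ ^ 2 * ∑ i, ‖v i‖ ^ 2 := by
    simp only [Pi.smul_apply, smul_eq_mul, norm_mul, mul_pow, Finset.mul_sum]
  rw [h2] at h1
  have hpos : 0 < ∑ i, ‖v i‖ ^ 2 := by
    obtain ⟨i, hi⟩ := Function.ne_iff.mp hv
    have hi' : 0 < ‖v i‖ ^ 2 := by positivity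
    exact lt_of_lt_of_le hi'
      (Finset.single_le_sum (f := fun j => ‖v j‖ ^ 2) (fun j _ => by positivity) (Finset.mem_univ i))
  have h3 : ‖z‖ ^ 2 ≤ ‖hopMatrix ρ V‖ ^ 2 := le_of_mul_le_mul_right h1 hpos
  have h4 : ‖z‖ ≤ ‖hopMatrix ρ V‖ := le_of_pow_le_pow_left₀ two_ne_zero (norm_nonneg _) h3
  exact h4.trans (l2_opNorm_hopMatrix_le ρ hρ V)

end Norm

/-! ## The expansion -/

section LogDet

/-- The dimension of the quark space: `#(site × colour × spin) = L⁴ · N · 4`. -/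
theorem card_index : Fintype.card (TorusSite 4 L × Fin N × Fin 4) = L ^ 4 * N * 4 := by
  simp only [Fintype.card_prod, Fintype.card_pi, Finset.prod_const, ZMod.card, Finset.card_univ,
    Fintype.card_fin]
  ring

include hρ in
/-- **The `log det` expansion of `1 - κ H`.**  For `0 ≤ κ` with `8κ < 1`: `det (1 - κ H) ≠ 0`, the
series `Σ_k κᵏ tr(Hᵏ)/k` converges (term `k = 0` is `0`), and `log |det (1 - κ H)| = - Re Σ_k κᵏ tr(Hᵏ)/k`. -/
theorem logDet_hopMatrix (V : GaugeConfig 4 L G) {κ : ℝ} (hκ0 : 0 ≤ κ) (hκ : κ * 8 < 1) :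
    ((1 : Matrix _ _ ℂ) - (κ : ℂ) • hopMatrix ρ V).det ≠ 0 ∧
      Summable (fun k : ℕ => (κ : ℂ) ^ k * (hopMatrix ρ V ^ k).trace / k) ∧
      Real.log ‖((1 : Matrix _ _ ℂ) - (κ : ℂ) • hopMatrix ρ V).det‖ =
        -(∑' k : ℕ, (κ : ℂ) ^ k * (hopMatrix ρ V ^ k).trace / k).re :=
  log_norm_det_one_sub_smul (hopMatrix ρ V) hκ0 hκ
    (fun _ hz => norm_le_eight_of_mem_roots ρ hρ V hz)
    (trace_pow_eq_sum_roots_pow _) (det_one_sub_smul_eq_prod_roots _ _)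

include hρ in
/-- **Termwise bound**: `‖κᵏ tr(Hᵏ)/k‖ ≤ dim · (8κ)ᵏ / k`. -/
theorem norm_term_hopMatrix_le (V : GaugeConfig 4 L G) {κ : ℝ} (hκ0 : 0 ≤ κ) (k : ℕ) :
    ‖(κ : ℂ) ^ k * (hopMatrix ρ V ^ k).trace / k‖ ≤
      Fintype.card (TorusSite 4 L × Fin N × Fin 4) * (κ * 8) ^ k / k :=
  norm_term_le _ hκ0
    (fun k => norm_trace_pow_le _ (fun _ hz => norm_le_eight_of_mem_roots ρ hρ V hz) k) k

include hρ in
/-- **Two fields compared.**  For gauge fields `V`, `V'` and `0 ≤ κ`, `8κ < 1`, and any cut `K`: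
`log |det (1 - κ H_V)| - log |det (1 - κ H_{V'})|
  = - Re Σ_{k<K} (f_V k - f_{V'} k) - Re Σ_k (f_V (k+K) - f_{V'} (k+K))`, `f_V k = κᵏ tr(H_Vᵏ)/k`. -/
theorem log_norm_det_sub_eq (V V' : GaugeConfig 4 L G) {κ : ℝ} (hκ0 : 0 ≤ κ) (hκ : κ * 8 < 1)
    (K : ℕ) :
    Real.log ‖((1 : Matrix _ _ ℂ) - (κ : ℂ) • hopMatrix ρ V).det‖ -
        Real.log ‖((1 : Matrix _ _ ℂ) - (κ : ℂ) • hopMatrix ρ V').det‖ =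
      -(∑ k ∈ Finset.range K, ((κ : ℂ) ^ k * (hopMatrix ρ V ^ k).trace / k -
          (κ : ℂ) ^ k * (hopMatrix ρ V' ^ k).trace / k)).re -
        (∑' k : ℕ, ((κ : ℂ) ^ (k + K) * (hopMatrix ρ V ^ (k + K)).trace / (k + K : ℕ) -
          (κ : ℂ) ^ (k + K) * (hopMatrix ρ V' ^ (k + K)).trace / (k + K : ℕ))).re := by
  obtain ⟨-, hsV, hlogV⟩ := logDet_hopMatrix ρ hρ V hκ0 hκ
  obtain ⟨-, hsV', hlogV'⟩ := logDet_hopMatrix ρ hρ V' hκ0 hκ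
  have hsub := hsV.sub hsV'
  have h1 := hsV.tsum_sub hsV'
  rw [← hsub.sum_add_tsum_nat_add K] at h1
  have h2 := congrArg Complex.re h1
  rw [Complex.sub_re, Complex.add_re] at h2
  rw [hlogV, hlogV']
  linarith

include hρ in
/-- **The tail.**  For `0 < K`: `‖Σ_k (f_V (k+K) - f_{V'} (k+K))‖ ≤ (2 dim / K) (8κ)^K / (1 - 8κ)`. -/
theorem norm_tsum_tail_sub_le (V V' : GaugeConfig 4 L G) {κ : ℝ} (hκ0 : 0 ≤ κ) (hκ : κ * 8 < 1)
    {K : ℕ} (hK : 0 < K) :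
    ‖∑' k : ℕ, ((κ : ℂ) ^ (k + K) * (hopMatrix ρ V ^ (k + K)).trace / (k + K : ℕ) -
          (κ : ℂ) ^ (k + K) * (hopMatrix ρ V' ^ (k + K)).trace / (k + K : ℕ))‖ ≤
      2 * Fintype.card (TorusSite 4 L × Fin N × Fin 4) / K * (κ * 8) ^ K / (1 - κ * 8) := by
  have hB : (0 : ℝ) ≤ 2 * Fintype.card (TorusSite 4 L × Fin N × Fin 4) := by positivity
  refine norm_tsum_shift_le (f := fun k => (κ : ℂ) ^ k * (hopMatrix ρ V ^ k).trace / k -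
      (κ : ℂ) ^ k * (hopMatrix ρ V' ^ k).trace / k) hB (by positivity) hκ (fun k => ?_) hK
  calc ‖(κ : ℂ) ^ k * (hopMatrix ρ V ^ k).trace / k - (κ : ℂ) ^ k * (hopMatrix ρ V' ^ k).trace / k‖
      ≤ ‖(κ : ℂ) ^ k * (hopMatrix ρ V ^ k).trace / k‖ + ‖(κ : ℂ) ^ k * (hopMatrix ρ V' ^ k).trace / k‖ :=
        norm_sub_le _ _
    _ ≤ Fintype.card (TorusSite 4 L × Fin N × Fin 4) * (κ * 8) ^ k / k +
          Fintype.card (TorusSite 4 L × Fin N × Fin 4) * (κ * 8) ^ k / k :=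
        add_le_add (norm_term_hopMatrix_le ρ hρ V hκ0 k) (norm_term_hopMatrix_le ρ hρ V' hκ0 k)
    _ = 2 * Fintype.card (TorusSite 4 L × Fin N × Fin 4) * (κ * 8) ^ k / k := by ring

end LogDet

end Summit.QuantumFields.QCD.Theorems.SmallHopping
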